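import Summits.ABC.StewartYu.PadicG3HalfSplit
import Summits.ABC.StewartYu.PadicComplexLiouville
import Literature.NumberTheory.LFunctions.DworkRationalityBorelDwork
import HarnessLib

/-!
# Cell abc-stewartyu, crux `Y07Odd` (stmt-ABC-19658), line `gen3-slab-odd`: the Kummer half-step, part 3 — SEPARATION at a half point:
# `p`-adic smallness of `φ_τ(s/2)` forces both signed parity class-sum vectors to vanish (generic family, any odd `p`)

`Summits/ABC/StewartYu/PadicG3HalfSeparation.lean` — sequel to `PadicG3HalfSplit` (cell `abc-stewartyu`, design HOME/p2/HALFSTEP-ODD.md; seat p2-g4,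
F-odd lead).  One theorem on `G3Setup`; no named fact.  Twin of M2's `PadicTwistPMHalfSeparation.classSums_eq_zero_of_norm_Φ_half_lt`
for the generic family `(R, v)` with natural root exponents `e i` (common unit `U`, exponent class `Σ r_j eᵢⱼ = c₀ + kᵢ M`): under the SIGNED
Kummer condition on the generators `α_j` (`¬IsSquare(±∏_{T} α_j)` for nonempty `T`), if the two class-sum vectors `C₀, C₁` of
`PadicG3HalfSplit.half_sum_eq_evL` have a common denominator `D`, total size `≤ Mb`, and
`‖φ_τ(s/2)‖_p < D/(4D²·Mb·(∏H(α_j))³)^{2^{n+1}}`, then `C₀ = 0` and `C₁ = 0` (the `ℂ_p` Liouville inequality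
`TwistHalf.norm_evL_add_iota_mul_ge`; `‖U‖ = ‖ξ‖ = 1`).

WHAT THIS IS NOT: no re-indexing/descent (part 4); no parameters; no crux moves.

References: K. Yu, Compositio 74 (1990) Lemma 2.5; M. Waldschmidt, Acta Arith. 37 (1980) Lemma 3.7; cell memo HOME/p3/memo-05 §3 (PM).
-/

noncomputable section

open NormedSpace Finset Polynomial IsUltrametricDist
open Literature.NumberTheory.Transcendental
open Literature.NumberTheory.Transcendental.CW77.Setup (Tau tauNorm)
open scoped Nat

namespace Summit.ABC.StewartYu

namespace G3Setup

variable {p : ℕ} [Fact p.Prime] (S : G3Setup p) {ι : Type*} (R : ι → ℚ[X]) (v : ι → Fin S.n → ℤ)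

/-- **Separation at a half point (any odd `p`, generic family).** In the setting of `g3Φ_half_complex_split` (common unit `U` with `‖U‖ = 1`,
natural root exponents `e i` in one exponent class, root data `sq_j = ŝ_j ξ^{r_j}`, `ŝ_j² = α_j`, `‖ŝ_j‖ ≤ 1`, `ξ^M = ι`, `ι² = −1`, `‖ξ‖ = 1`),
under the signed Kummer condition: if the class-sum vectors `C₀` (even `kᵢ`) and `C₁` (odd `kᵢ`) satisfy `D·C_b ∈ ℤ`, `Σ|C₀| + Σ|C₁| ≤ Mb`, and
`‖φ_τ(s/2)‖_p < D/(4D²Mb(∏H(α_j))³)^{2^{n+1}}`, then `C₀ = 0` and `C₁ = 0`. [cite: Yu1990, Lemma 2.5] [cite: Waldschmidt1980, Lemma 3.7] -/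
theorem classSums_eq_zero_of_norm_g3Φ_half_lt (B : Finset ι) (pv : ι → ℤ) (τ : Tau S.n) (s : ℤ) (U : ℚ_[p]) (hU : ‖U‖ = 1)
    (e : ι → Fin S.n → ℕ) (he : ∀ i ∈ B, ∏ j, S.sq j ^ (v i j * s) = U * ∏ j, S.sq j ^ e i j)
    (ŝ : Fin S.n → ℂ_[p]) (ξ ιC : ℂ_[p]) (r : Fin S.n → ℕ) {M c₀ : ℕ} (k : ι → ℕ)
    (hσ : ∀ j, algebraMap ℚ_[p] ℂ_[p] (S.sq j) = ŝ j * ξ ^ r j)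
    (hι : ξ ^ M = ιC) (hι2 : ιC ^ 2 = -1) (hξ : ‖ξ‖ = 1)
    (hcls : ∀ i ∈ B, ∑ j, r j * e i j = c₀ + k i * M)
    (hŝ : ∀ j, ŝ j * ŝ j = (S.α j : ℂ_[p])) (hŝ1 : ∀ j, ‖ŝ j‖ ≤ 1)
    (hind : ∀ T : Finset (Fin S.n), T.Nonempty → ¬ IsSquare (∏ j ∈ T, S.α j) ∧ ¬ IsSquare (-∏ j ∈ T, S.α j))
    {D : ℕ} (hD : 1 ≤ D) {Mb : ℝ} (hMb : 1 ≤ Mb)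
    (hden₀ : ∀ T', ∃ z : ℤ, (D : ℚ) * (∑ i ∈ (B.filter (fun i => Even (k i))) with HalfMono.SsetG (e i) = T',
        (((-1) ^ (k i / 2) * pv i : ℤ) : ℚ) *
          (((hasseDeriv τ.1 (R i)).eval ((s : ℚ) / 2) * S.zγpow v i τ.2) * HalfMono.qEhG S.α (e i))) = z)
    (hden₁ : ∀ T', ∃ z : ℤ, (D : ℚ) * (∑ i ∈ (B.filter (fun i => ¬ Even (k i))) with HalfMono.SsetG (e i) = T',
        (((-1) ^ (k i / 2) * pv i : ℤ) : ℚ) *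
          (((hasseDeriv τ.1 (R i)).eval ((s : ℚ) / 2) * S.zγpow v i τ.2) * HalfMono.qEhG S.α (e i))) = z)
    (hcM : ∑ T', |((∑ i ∈ (B.filter (fun i => Even (k i))) with HalfMono.SsetG (e i) = T',
        (((-1) ^ (k i / 2) * pv i : ℤ) : ℚ) *
          (((hasseDeriv τ.1 (R i)).eval ((s : ℚ) / 2) * S.zγpow v i τ.2) * HalfMono.qEhG S.α (e i)) : ℚ) : ℝ)| +
      ∑ T', |((∑ i ∈ (B.filter (fun i => ¬ Even (k i))) with HalfMono.SsetG (e i) = T',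
        (((-1) ^ (k i / 2) * pv i : ℤ) : ℚ) *
          (((hasseDeriv τ.1 (R i)).eval ((s : ℚ) / 2) * S.zγpow v i τ.2) * HalfMono.qEhG S.α (e i)) : ℚ) : ℝ)| ≤ Mb)
    (hlt : ‖S.g3Φ R v B pv τ ((2 : ℚ_[p])⁻¹ * (s : ℚ_[p]))‖ <
      (D : ℝ) / (4 * (D : ℝ) ^ 2 * Mb * CW77.heightProd S.α ^ 3) ^ (2 ^ (S.n + 1))) :
    (fun T' => ∑ i ∈ (B.filter (fun i => Even (k i))) with HalfMono.SsetG (e i) = T',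
        (((-1) ^ (k i / 2) * pv i : ℤ) : ℚ) *
          (((hasseDeriv τ.1 (R i)).eval ((s : ℚ) / 2) * S.zγpow v i τ.2) * HalfMono.qEhG S.α (e i))) = 0 ∧
    (fun T' => ∑ i ∈ (B.filter (fun i => ¬ Even (k i))) with HalfMono.SsetG (e i) = T',
        (((-1) ^ (k i / 2) * pv i : ℤ) : ℚ) *
          (((hasseDeriv τ.1 (R i)).eval ((s : ℚ) / 2) * S.zγpow v i τ.2) * HalfMono.qEhG S.α (e i))) = 0 := by
  classical
  set C₀ : Finset (Fin S.n) → ℚ := fun T' =>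
    ∑ i ∈ (B.filter (fun i => Even (k i))) with HalfMono.SsetG (e i) = T',
      (((-1) ^ (k i / 2) * pv i : ℤ) : ℚ) *
        (((hasseDeriv τ.1 (R i)).eval ((s : ℚ) / 2) * S.zγpow v i τ.2) * HalfMono.qEhG S.α (e i)) with hC₀
  set C₁ : Finset (Fin S.n) → ℚ := fun T' =>
    ∑ i ∈ (B.filter (fun i => ¬ Even (k i))) with HalfMono.SsetG (e i) = T',
      (((-1) ^ (k i / 2) * pv i : ℤ) : ℚ) *
        (((hasseDeriv τ.1 (R i)).eval ((s : ℚ) / 2) * S.zγpow v i τ.2) * HalfMono.qEhG S.α (e i)) with hC₁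
  by_contra hne
  -- the value in `ℂ_p`
  have hval : algebraMap ℚ_[p] ℂ_[p] (S.g3Φ R v B pv τ ((2 : ℚ_[p])⁻¹ * (s : ℚ_[p]))) =
      algebraMap ℚ_[p] ℂ_[p] U * (ξ ^ c₀ * (Multiquad.evL ŝ C₀ + ιC * Multiquad.evL ŝ C₁)) := by
    rw [S.g3Φ_half_complex_split R v B pv τ s U e he ŝ ξ ιC r k hσ hι hι2 hcls,
      S.half_sum_eq_evL R v _ pv τ s e ŝ hŝ k, S.half_sum_eq_evL R v _ pv τ s e ŝ hŝ k]
  -- norms: `‖φ(s/2)‖_p = ‖evL ŝ C₀ + ι evL ŝ C₁‖`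
  have hUn : ‖algebraMap ℚ_[p] ℂ_[p] U‖ = 1 := by
    rw [show algebraMap ℚ_[p] ℂ_[p] U = ((U : ℚ_[p]) : ℂ_[p]) from rfl, PadicComplex.norm_extends', hU]
  have hnorm : ‖S.g3Φ R v B pv τ ((2 : ℚ_[p])⁻¹ * (s : ℚ_[p]))‖ = ‖Multiquad.evL ŝ C₀ + ιC * Multiquad.evL ŝ C₁‖ := by
    rw [← PadicComplex.norm_extends', show ((S.g3Φ R v B pv τ ((2 : ℚ_[p])⁻¹ * (s : ℚ_[p])) : ℚ_[p]) : ℂ_[p]) =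
      algebraMap ℚ_[p] ℂ_[p] (S.g3Φ R v B pv τ ((2 : ℚ_[p])⁻¹ * (s : ℚ_[p]))) from rfl, hval,
      norm_mul, norm_mul, norm_pow, hUn, hξ, one_pow, one_mul, one_mul]
  -- Liouville in `ℂ_p`
  have hιmul : ιC * ιC = -1 := by rw [← pow_two]; exact hι2
  have key := TwistHalf.norm_evL_add_iota_mul_ge
    (L := ℂ_[p]) (fun z => Literature.NumberTheory.LFunctions.Dwork.norm_intCast_le_one p z)
    (fun n hn => PadicComplexFacts.inv_natCast_le_norm_natCast hn) S.α hind ŝ hŝ hŝ1 ιC hιmul C₀ C₁ hne D hD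
    hden₀ hden₁ Mb hMb hcM
  rw [hnorm] at hlt
  exact absurd (lt_of_le_of_lt key hlt) (lt_irrefl _)

end G3Setup

end Summit.ABC.StewartYu

end
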